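import Literature.NumberTheory.GaloisRepresentations.IdeleTruncation
import Literature.NumberTheory.GaloisRepresentations.IdeleCohomologySubgroups
import Literature.NumberTheory.GaloisRepresentations.SemiLocalShapiro
import Literature.NumberTheory.Automorphic.IdeleNormTowerProofs
import HarnessLib

/-!
# Finite level: a class of `Hⁿ(H, Res_H J_{E,S})` (`H ≤ Gal(E/F)`, `J_{E,S}` the idèles truncated at `S`, `n ≥ 1`)
# all of whose local components over the places of `E^H` vanish is zero; the components off `S ∪ ∞` vanish
# identically (Tate, C–F VII §7.3 Prop. 7.3 for `J_{E,S}` restricted to a subgroup; Harari Prop. 13.1 (b), §17.5)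

Topic `NumberTheory/GaloisRepresentations`; namespace `Literature.NumberTheory.GaloisRepresentations.IdeleHerbrand`.  Sequel to
bsd-line-x1-p1-w6's `IdeleTruncation.lean` (`truncRep F E S = J_{E,S}` as a `Gal(E/F)`-module, the equivariant truncation
`truncOf`), door-c5's `IdeleCohomologySubgroups.lean` (`groupCohomologyResIdeleRepIso H n : Hⁿ(H, Res_H J_E) ≅ Hⁿ(Gal(E/E^H), J_E)`)
and `IdeleCohomologyLimit.lean` (`eq_zero_of_placeComponents_eq_zero`: Tate's Prop. 7.3 elementwise, `placeProj`,
`infPlaceProj`).  Two plumbing definitions with bodies (the inclusion `J_{E,S} ↪ J_E` and the truncation `J_E ↠ J_{E,S}` as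
morphisms of `Rep ℤ Gal(E/F)`) and theorems; no named fact, no instance, no notation, no `sorry`; number fields in `Type`.

THE POINT (brick E3 / [P2-mono] of the `Ext` road of lane «PT-Ш-S-TC», file P2-b of bsd-line-x1-p1-w3 g18's
`P2-MONO-SCOPING-w3g18-v2.md` §1 (d)).  The injectivity of `Ext²_{C_{G_S}}(A, Ī_S) → ∏_{w ∣ S ∪ ∞} Ext²(φ_w^* A, K̄_wˣ)` is
read, on a relative layer `F ⊂ K_S` of an open `W ≤ G_S`, in the finite group `Hⁿ(H_F, Res_{H_F} J_{F,S})` (P2-a,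
`relLayerISCohomologyIso`); there one needs: **a class `c ∈ Hⁿ(H, Res_H J_{E,S})` whose local components at the places of
`L = E^H` vanish is zero**.  Route: `J_{E,S}` is an equivariant RETRACT of `J_E` (`truncInclHom ≫ truncProjHom = 𝟙`), so
`Hⁿ(H, Res_H J_{E,S}) ↪ Hⁿ(H, Res_H J_E) ≅ Hⁿ(Gal(E/L), J_E)` (door-c5's transport to the base `L = E^H`), where Tate's
Prop. 7.3 (door-c5 `eq_zero_of_placeComponents_eq_zero`) says that the local components detect classes; and the component at a
finite place `u` of `L` NOT above `S` vanishes identically on classes from `J_{E,S}` (the `u`-block of a truncated idèle is `1`).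

* §1 `truncInclHom S : truncRep F E S ⟶ ideleRep F E`, `truncProjHom S : ideleRep F E ⟶ truncRep F E S`,
  `truncInclHom_comp_truncProjHom` (the retract); generic `map_resMap_injective_of_comp_eq_id` (a retract of `Rep`s is a
  split mono on `Hⁿ(H, Res_H ·)`), `groupCohomology_map_zero_hom`, `map_map_map_eq_zero_of_forall` (abstract bookkeeping).
* §2 `truncComponentClass S H n c` := the image of `c` in `Hⁿ(Gal(E/E^H), J_E)`;
  **`eq_zero_of_placeComponents_truncComponentClass_eq_zero`** — `c = 0` as soon as all finite and infinite place components of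
  `truncComponentClass S H n c` over `E^H` vanish (`n ≥ 1`).
* §3 `blockHom_eq_one_of_mem_truncIdeles` (the `u`-block of `x ∈ J_{E,S}` is `1` for `u ∤ S`),
  **`placeComponent_truncComponentClass_eq_zero_of_not_mem`** (those components vanish identically), and the sharpened
  criterion **`eq_zero_of_placeComponents_eq_zero_above`** (only the finite places of `E^H` ABOVE `S` and the infinite places
  need checking).

HONEST FRAMING: finite-level idèle bookkeeping (Tate's Prop. 7.3 for the truncated idèles at a subgroup); the matching of
these components with the local layers of the `Ext` road is P2-e (LEAD), no case of Poitou–Tate and no case of BSD is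
proved here.  Cell `bsd-eis`, crux `GoodLatticeBDPValue` (stmt-BirchSwinnertonDyer-19032), seat bsd-line-x1-p1-w8 g13
(LEAD g11 ROUTING #11 (b)).

## References
* J. W. S. Cassels, A. Fröhlich (eds.), *Algebraic Number Theory* (1967), Ch. VII (J. Tate) §7.3 Prop. 7.3. [CasselsFrohlichANT1967]
* D. Harari, *Galois Cohomology and Class Field Theory*, Universitext (2020), §13.1 Prop. 13.1 (b), §17.4 Def. 17.22,
  §17.5 Prop. 17.25. [Harari2020]
* J.-P. Serre, *Local Fields*, GTM 67 (1979), VII §5 (functoriality of cohomology). [Serre1979]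
-/

noncomputable section

open NumberField IsDedekindDomain CategoryTheory CategoryTheory.Limits groupCohomology
open Literature.NumberTheory.Automorphic

namespace Literature.NumberTheory.GaloisRepresentations

namespace IdeleHerbrand

/-! ## §1. The retract `J_{E,S} ↪ J_E ↠ J_{E,S}` and abstract bookkeeping -/

section Generic

/-- **A retract of representations is a split mono on `Hⁿ(H, Res_H ·)`**: if `i ≫ r = 𝟙 A` in `Rep ℤ G` then
`Hⁿ(H, Res_H i)` is injective for every subgroup `H ≤ G` and every `n`. [cite: Serre1979, VII §5] -/
theorem map_resMap_injective_of_comp_eq_id {G : Type} [Group G] {A B : Rep ℤ G} (i : A ⟶ B) (r : B ⟶ A)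
    (h : i ≫ r = 𝟙 A) (H : Subgroup G) (n : ℕ) :
    Function.Injective (groupCohomology.map (A := Rep.res H.subtype A) (B := Rep.res H.subtype B)
      (MonoidHom.id H) (Rep.resMap H.subtype i) n) := by
  have hcomp : Rep.resMap H.subtype i ≫ Rep.resMap H.subtype r = 𝟙 (Rep.res H.subtype A) := by
    change (Rep.resFunctor H.subtype).map i ≫ (Rep.resFunctor H.subtype).map r = _
    rw [← CategoryTheory.Functor.map_comp, h, CategoryTheory.Functor.map_id]
  intro x y hxy
  have hx := congrArg (groupCohomology.map (A := Rep.res H.subtype B) (B := Rep.res H.subtype A)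
    (MonoidHom.id H) (Rep.resMap H.subtype r) n) hxy
  rw [← IdeleCohomology.map_comp_apply, ← IdeleCohomology.map_comp_apply, hcomp, groupCohomology.map_id] at hx
  exact hx

/-- `Hⁿ(f, 0) = 0`: the map on cohomology induced by the zero morphism vanishes (Mathlib `cochainsMap_zero`).
[cite: Serre1979, VII §5] -/
theorem groupCohomology_map_zero_hom {G H : Type} [Group G] [Group H] {A : Rep ℤ H} {B : Rep ℤ G} (f : G →* H)
    (n : ℕ) : groupCohomology.map f (0 : Rep.res f A ⟶ B) n = 0 := by
  change HomologicalComplex.homologyMap (groupCohomology.cochainsMap f (0 : Rep.res f A ⟶ B)) n = 0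
  rw [groupCohomology.cochainsMap_zero, HomologicalComplex.homologyMap_zero]

/-- **Bookkeeping over abstract representations**: a threefold composite `Hⁿ(g, χ) ∘ Hⁿ(e, ψ) ∘ Hⁿ(id, φ)` vanishes when the
composite of the underlying maps of vectors `χ ∘ ψ ∘ φ` vanishes (Mathlib `groupCohomology.map_comp`; stated abstractly so
that no concrete representation is unfolded by the rewriting). [cite: Serre1979, VII §5] -/
theorem map_map_map_eq_zero_of_forall {K H G : Type} [Group K] [Group H] [Group G] {A A' : Rep ℤ K} {B : Rep ℤ H}
    {C : Rep ℤ G} (φ : A ⟶ A') (e : H →* K) (ψ : Rep.res e A' ⟶ B) (g : G →* H) (χ : Rep.res g B ⟶ C)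
    (hzero : ∀ x : A.V, χ.hom (ψ.hom (φ.hom x)) = 0) (n : ℕ) (c : groupCohomology A n) :
    groupCohomology.map g χ n (groupCohomology.map e ψ n (groupCohomology.map (MonoidHom.id K) φ n c)) = 0 := by
  have key : ∀ (f : G →* K) (Θ : Rep.res f A ⟶ C), (∀ x : A.V, Θ.hom x = 0) → groupCohomology.map f Θ n = 0 :=
    fun f Θ hΘ => by
      -- the `ℤ`-module structures carried by the `Rep` objects
      letI := A.hV2
      letI := C.hV2
      have hΘ0 : Θ = 0 := Rep.hom_ext (Representation.IntertwiningMap.ext (LinearMap.ext fun x => hΘ x))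
      rw [hΘ0]
      exact groupCohomology_map_zero_hom f n
  have hc : (groupCohomology.map (MonoidHom.id K) φ n ≫ groupCohomology.map e ψ n ≫ groupCohomology.map g χ n) c = 0 := by
    rw [← groupCohomology.map_comp, ← groupCohomology.map_comp, key _ _ fun x => hzero x]
    rfl
  exact hc

end Generic

variable {F : Type} [Field F] [NumberField F] {E : Type} [Field E] [NumberField E] [Algebra F E]
variable (S : Finset (HeightOneSpectrum (𝓞 F)))

/-- **The inclusion `J_{E,S} ↪ J_E` as a morphism of `Rep ℤ Gal(E/F)`** (the subgroup embedding; equivariant by the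
definition of `truncRep`). [cite: Harari2020, §17.4 Def. 17.22] -/
def truncInclHom : truncRep F E S ⟶ IdeleClassGroup.ideleRep F E :=
  Rep.ofHom ⟨(MonoidHom.toAdditive (truncIdeles F E S).subtype).toIntLinearMap, fun _ => LinearMap.ext fun _ => rfl⟩

/-- Unfolding: `truncInclHom` is the subgroup embedding on idèles. [cite: Harari2020, §17.4 Def. 17.22] -/
theorem toMul_truncInclHom_apply (x : (truncRep F E S).V) :
    Additive.toMul ((truncInclHom S).hom x) = ((Additive.toMul x : truncIdeles F E S) : ideleGroup E) := rfl

/-- **The truncation `J_E ↠ J_{E,S}`, `x ↦ x^{(S)}`, as a morphism of `Rep ℤ Gal(E/F)`** (bsd-line-x1-p1-w6's `truncMonoidHom`,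
equivariant by `truncOf_smul`). [cite: Harari2020, Lemma 15.39 (proof), §17.4 (17.1)] -/
def truncProjHom : IdeleClassGroup.ideleRep F E ⟶ truncRep F E S :=
  Rep.ofHom ⟨(MonoidHom.toAdditive ((truncMonoidHom F E S).codRestrict (truncIdeles F E S) fun x => truncOf_mem S x)).toIntLinearMap,
    fun g => LinearMap.ext fun x => by
      apply Additive.toMul.injective
      apply Subtype.ext
      exact truncOf_smul S g (Additive.toMul x)⟩

/-- Unfolding: `truncProjHom` is `x ↦ x^{(S)}` on idèles. [cite: Harari2020, Lemma 15.39 (proof)] -/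
theorem coe_toMul_truncProjHom_apply (x : (IdeleClassGroup.ideleRep F E).V) :
    ((Additive.toMul ((truncProjHom S).hom x) : truncIdeles F E S) : ideleGroup E) = truncOf S (Additive.toMul x) := rfl

/-- **`J_{E,S}` is an equivariant retract of `J_E`**: `truncInclHom ≫ truncProjHom = 𝟙` (the truncation is the identity on
`J_{E,S}`, `truncOf_eq_self`). [cite: Harari2020, Lemma 15.39 (proof)][cite: CasselsFrohlichANT1967, Ch. VII §7.3] -/
theorem truncInclHom_comp_truncProjHom : truncInclHom S ≫ truncProjHom S = 𝟙 (truncRep F E S) :=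
  Rep.hom_ext (Representation.IntertwiningMap.ext (LinearMap.ext fun x => by
    apply Additive.toMul.injective
    apply Subtype.ext
    exact truncOf_eq_self S (Additive.toMul x).2))

/-- **`Hⁿ(H, Res_H J_{E,S}) ↪ Hⁿ(H, Res_H J_E)`** for every subgroup `H ≤ Gal(E/F)` and every `n` (split mono).
[cite: CasselsFrohlichANT1967, Ch. VII §7.3][cite: Serre1979, VII §5] -/
theorem map_resMap_truncInclHom_injective (H : Subgroup (E ≃ₐ[F] E)) (n : ℕ) :
    Function.Injective (groupCohomology.map (A := Rep.res H.subtype (truncRep F E S))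
      (B := Rep.res H.subtype (IdeleClassGroup.ideleRep F E)) (MonoidHom.id H) (Rep.resMap H.subtype (truncInclHom S)) n) :=
  map_resMap_injective_of_comp_eq_id (truncInclHom S) (truncProjHom S) (truncInclHom_comp_truncProjHom S) H n

/-! ## §2. The class in `Hⁿ(Gal(E/E^H), J_E)` and Tate's Prop. 7.3 -/

/-- **The image of `c ∈ Hⁿ(H, Res_H J_{E,S})` in `Hⁿ(Gal(E/L), J_E)`, `L = E^H`**: push along `J_{E,S} ↪ J_E`, then door-c5's
transport `Hⁿ(H, Res_H J_E) ≅ Hⁿ(Gal(E/E^H), J_E)` (`groupCohomologyResIdeleRepIso`). [cite: CasselsFrohlichANT1967, Ch. VII §7.3] -/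
def truncComponentClass [IsGalois F E] (H : Subgroup (E ≃ₐ[F] E)) (n : ℕ)
    (c : groupCohomology (Rep.res H.subtype (truncRep F E S)) n) :
    groupCohomology (IdeleClassGroup.ideleRep (IntermediateField.fixedField H) E) n :=
  (IdeleCohomology.groupCohomologyResIdeleRepIso H n).hom
    (groupCohomology.map (A := Rep.res H.subtype (truncRep F E S)) (B := Rep.res H.subtype (IdeleClassGroup.ideleRep F E))
      (MonoidHom.id H) (Rep.resMap H.subtype (truncInclHom S)) n c)

/-- Formula. [cite: CasselsFrohlichANT1967, Ch. VII §7.3] -/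
theorem truncComponentClass_def [IsGalois F E] (H : Subgroup (E ≃ₐ[F] E)) (n : ℕ)
    (c : groupCohomology (Rep.res H.subtype (truncRep F E S)) n) :
    truncComponentClass S H n c = (IdeleCohomology.groupCohomologyResIdeleRepIso H n).hom
      (groupCohomology.map (A := Rep.res H.subtype (truncRep F E S)) (B := Rep.res H.subtype (IdeleClassGroup.ideleRep F E))
        (MonoidHom.id H) (Rep.resMap H.subtype (truncInclHom S)) n c) := rfl

/-- `truncComponentClass` is additive (a composite of additive maps). [cite: CasselsFrohlichANT1967, Ch. VII §7.3] -/
theorem truncComponentClass_add [IsGalois F E] (H : Subgroup (E ≃ₐ[F] E)) (n : ℕ)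
    (c c' : groupCohomology (Rep.res H.subtype (truncRep F E S)) n) :
    truncComponentClass S H n (c + c') = truncComponentClass S H n c + truncComponentClass S H n c' := by
  rw [truncComponentClass_def, truncComponentClass_def, truncComponentClass_def, map_add, map_add]

/-- **`truncComponentClass c = 0 ↔ c = 0`** (transport by an isomorphism after a split mono).
[cite: CasselsFrohlichANT1967, Ch. VII §7.3] -/
theorem truncComponentClass_eq_zero_iff [IsGalois F E] (H : Subgroup (E ≃ₐ[F] E)) (n : ℕ)
    (c : groupCohomology (Rep.res H.subtype (truncRep F E S)) n) :
    truncComponentClass S H n c = 0 ↔ c = 0 := by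
  constructor
  · intro h0
    have h1 := congrArg (IdeleCohomology.groupCohomologyResIdeleRepIso H n).inv h0
    rw [truncComponentClass_def, Iso.hom_inv_id_apply, map_zero] at h1
    exact map_resMap_truncInclHom_injective S H n (h1.trans (map_zero _).symm)
  · rintro rfl
    rw [truncComponentClass_def, map_zero, map_zero]

/-- **Tate's Prop. 7.3 for `J_{E,S}` at a subgroup**: a class `c ∈ Hⁿ(H, Res_H J_{E,S})` (`n ≥ 1`) all of whose local
components — at every finite place `u` and every infinite place `u` of `L = E^H`, read on the image of `c` in
`Hⁿ(Gal(E/L), J_E)` through door-c5's `placeProj u` / `infPlaceProj u` — vanish, is zero.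
[cite: CasselsFrohlichANT1967, Ch. VII §7.3 Prop. 7.3][cite: Harari2020, §13.1 Prop. 13.1 (b)] -/
theorem eq_zero_of_placeComponents_truncComponentClass_eq_zero [IsGalois F E] (H : Subgroup (E ≃ₐ[F] E)) (n : ℕ)
    [NeZero n] (c : groupCohomology (Rep.res H.subtype (truncRep F E S)) n)
    (hfin : ∀ u : HeightOneSpectrum (𝓞 (IntermediateField.fixedField H)),
      groupCohomology.map (MonoidHom.id _) (IdeleCohomology.placeProj (E := E) u) n (truncComponentClass S H n c) = 0)
    (hinf : ∀ u : InfinitePlace (IntermediateField.fixedField H),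
      groupCohomology.map (MonoidHom.id _) (IdeleCohomology.infPlaceProj (E := E) u) n (truncComponentClass S H n c) = 0) :
    c = 0 :=
  (truncComponentClass_eq_zero_iff S H n c).1
    (IdeleCohomology.eq_zero_of_placeComponents_eq_zero (F := IntermediateField.fixedField H) (E := E) n _ hfin hinf)

/-! ## §3. The components at the finite places not above `S` vanish identically -/

omit [NumberField F] in
/-- **The `u`-block of a truncated idèle is `1` for `u ∤ S`**: for `x ∈ J_{E,S}`, an intermediate field `F ⊆ L ⊆ E` and a
finite place `u` of `L` with `u ∩ 𝓞_F ∉ S`, `blockHom L E u x = 1` (every `w ∣ u` has `w ∩ 𝓞_F = u ∩ 𝓞_F ∉ S`).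
[cite: Harari2020, §17.4 Def. 17.22][cite: CasselsFrohlichANT1967, Ch. VII §7.3] -/
theorem blockHom_eq_one_of_mem_truncIdeles {L : Type} [Field L] [NumberField L] [Algebra F L] [Algebra L E]
    [IsScalarTower F L E] {x : ideleGroup E} (hx : x ∈ truncIdeles F E S) (u : HeightOneSpectrum (𝓞 L))
    (hu : u.under (𝓞 F) ∉ S) : blockHom L E u x = 1 := by
  apply Units.ext
  funext w
  rw [blockHom_apply, Units.val_one, Pi.one_apply]
  refine hx (w : HeightOneSpectrum (𝓞 E)) ?_
  have hw : (w : HeightOneSpectrum (𝓞 E)).under (𝓞 F) = u.under (𝓞 F) :=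
    (HeightOneSpectrum.under_under F L E (w : HeightOneSpectrum (𝓞 E))).symm.trans
      (congrArg (fun u' => HeightOneSpectrum.under (𝓞 F) u') w.2)
  rw [hw]
  exact hu

/-- **The component at a finite place `u ∤ S` of `L = E^H` of (the image of) a class from `Hⁿ(H, Res_H J_{E,S})` is zero** —
identically, in every degree: the composite morphism `Res J_{E,S} ↪ Res J_E = J_E(L) ↠ ∏_{w∣u} E_wˣ` is zero on vectors.
[cite: CasselsFrohlichANT1967, Ch. VII §7.3][cite: Harari2020, §13.1 Prop. 13.1 (b)] -/
theorem placeComponent_truncComponentClass_eq_zero_of_not_mem [IsGalois F E] (H : Subgroup (E ≃ₐ[F] E)) (n : ℕ)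
    (c : groupCohomology (Rep.res H.subtype (truncRep F E S)) n) (u : HeightOneSpectrum (𝓞 (IntermediateField.fixedField H)))
    (hu : u.under (𝓞 F) ∉ S) :
    groupCohomology.map (MonoidHom.id _) (IdeleCohomology.placeProj (E := E) u) n (truncComponentClass S H n c) = 0 := by
  unfold truncComponentClass IdeleCohomology.groupCohomologyResIdeleRepIso
  rw [groupCohomology.mapIso_hom]
  refine map_map_map_eq_zero_of_forall _ _ _ _ _ (fun x => ?_) n c
  exact congrArg Additive.ofMul
    (blockHom_eq_one_of_mem_truncIdeles S (L := IntermediateField.fixedField H) (Additive.toMul x).2 u hu)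

/-- **Sharpened criterion**: a class `c ∈ Hⁿ(H, Res_H J_{E,S})` (`n ≥ 1`) is zero as soon as its local components at the
finite places of `L = E^H` ABOVE `S` and at the infinite places of `L` vanish (the other finite components vanish by
`placeComponent_truncComponentClass_eq_zero_of_not_mem`). [cite: CasselsFrohlichANT1967, Ch. VII §7.3 Prop. 7.3]
[cite: Harari2020, §13.1 Prop. 13.1 (b), §17.5 Prop. 17.25] -/
theorem eq_zero_of_placeComponents_eq_zero_above [IsGalois F E] (H : Subgroup (E ≃ₐ[F] E)) (n : ℕ) [NeZero n]
    (c : groupCohomology (Rep.res H.subtype (truncRep F E S)) n)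
    (hfin : ∀ u : HeightOneSpectrum (𝓞 (IntermediateField.fixedField H)), u.under (𝓞 F) ∈ S →
      groupCohomology.map (MonoidHom.id _) (IdeleCohomology.placeProj (E := E) u) n (truncComponentClass S H n c) = 0)
    (hinf : ∀ u : InfinitePlace (IntermediateField.fixedField H),
      groupCohomology.map (MonoidHom.id _) (IdeleCohomology.infPlaceProj (E := E) u) n (truncComponentClass S H n c) = 0) :
    c = 0 :=
  eq_zero_of_placeComponents_truncComponentClass_eq_zero S H n c
    (fun u => (em (u.under (𝓞 F) ∈ S)).elim (hfin u)
      (placeComponent_truncComponentClass_eq_zero_of_not_mem S H n c u)) hinf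

end IdeleHerbrand

end Literature.NumberTheory.GaloisRepresentations

end
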